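import Summits.KontsevichZagierPeriods.KontsevichZagierPeriods.Theorems.TerasomaMultiplicationBetaCancellationStubTameFormAux11

/-!
# `BetaCancellation` (stmt-KontsevichZagierPeriods-13633), line `divisor-slicing-transshipment` — stub `stub_tameForm`, auxiliary file 12: rule (1b) has vanishing shadow

**Rule (1b) (additivity in the integrand) has vanishing `K₀`-shadow.** From the positive core
(`Shadow.of_integrandAdd_pos`, auxiliary file 11) by sign bookkeeping only:

* `Shadow.of_integrandAdd_posRight` — `[R] − [W] − [Q]` for `R = W + Q` with `R, Q > 0` and `W` of
  arbitrary sign: split the common domain by the sign of `W` (rule (1a) shadows) and use the core on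
  `{W > 0}` (`R = W + Q`), congruence on `{W = 0}` (`R = Q`), and the core on `{W < 0}`
  (`Q = R + (−W)`);
* `Shadow.of_mem_integrandAddRel` — for a generator `[r] − [r₁] − [r₂]`, `f = f₁ + f₂` on `σ`, put
  `q = |f₁| + |f₂| + 1/∏(1+xᵢ²) > 0` (integrable) and `p₁ = f₁ + q`, `p₂ = f₂ + q`, `p = f + 2q`, all
  positive; then `[r] − [r₁] − [r₂]` is the alternating sum of the five combinations
  `[p] − [p₁] − [p₂]`, `[2q] − [q] − [q]` (cores) and `[p] − [r] − [2q]`, `[p₁] − [r₁] − [q]`,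
  `[p₂] − [r₂] − [q]` (previous lemma).

References: M. Kontsevich, D. Zagier, *Periods* (2001), §1.2 rule (1); crux NOTES c6 (F13).
-/

noncomputable section

-- `Summit.KontsevichZagierPeriods.KontsevichZagierPeriods.…` is the tree's mandated layout (single-conjunct summit).
set_option linter.dupNamespace false

namespace Summit.KontsevichZagierPeriods.KontsevichZagierPeriods.BetaCancellationDivisorSlicing

open MeasureTheory Set Function
open Literature.NumberTheory.Transcendental
open Literature.NumberTheory.Transcendental.KZ
open Literature.ModelTheory.ExponentialFields (IsSemialgebraic isSemialgebraic_univ)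

variable {n : ℕ}

namespace Shadow

/-- Restriction of the three members of an integrand-additivity triple to a `ℚ`-semialgebraic part
of the common domain: the shadow of the triple is the sum of the shadows of the restricted triples
over a finite `ℚ`-semialgebraic partition. [folklore] -/
theorem of_triple_partition {K : ℕ} (R W Q : IntegralRep n) (hW : W.domain = R.domain)
    (hQ : Q.domain = R.domain) (E : Fin K → Set (Fin n → ℝ)) (hE : ∀ k, IsSemialgebraic ℚ (E k))
    (hEσ : ∀ k, E k ⊆ R.domain) (hdisj : ∀ k k', k ≠ k' → E k ∩ E k' = ∅)
    (hcov : R.domain ⊆ ⋃ k, E k)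
    (h : ∀ k, Nonempty (Shadow (of (R.restrict (E k) (hE k) (hEσ k)) -
      of (W.restrict (E k) (hE k) ((hEσ k).trans hW.symm.subset)) -
      of (Q.restrict (E k) (hE k) ((hEσ k).trans hQ.symm.subset))))) :
    Nonempty (Shadow (of R - of W - of Q)) := by
  have hpart : ∀ (X : IntegralRep n) (hX : X.domain = R.domain),
      Nonempty (Shadow (of X - ∑ k, of (X.restrict (E k) (hE k) ((hEσ k).trans hX.symm.subset)))) := by
    intro X hX
    refine of_partition X _ (fun k => (hEσ k).trans hX.symm.subset) (fun k => fun _ _ => rfl)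
      (fun k k' hkk => by simp [hdisj k k' hkk]) ?_
    refine measure_mono_null (fun x hx => ?_) measure_empty
    simp only [Set.mem_sdiff, IntegralRep.domain_restrict, hX] at hx
    exact hx.2 (hcov hx.1)
  obtain ⟨S₁⟩ := hpart R rfl
  obtain ⟨S₂⟩ := hpart W hW
  obtain ⟨S₃⟩ := hpart Q hQ
  obtain ⟨S₄⟩ := Shadow.sum Finset.univ _ fun k _ => h k
  obtain ⟨S⟩ := S₁.sub S₂
  obtain ⟨S⟩ := S.sub S₃
  obtain ⟨S⟩ := S.add S₄
  refine S.congr ?_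
  simp only [Finset.sum_sub_distrib]
  abel

/-- **`[R] − [W] − [Q]` has vanishing shadow for `R = W + Q` on a common domain with `R, Q > 0`
and `W` of arbitrary sign.** [cite: KontsevichZagier2001, §1.2 rule (1)] -/
theorem of_integrandAdd_posRight (R W Q : IntegralRep n) (hW : W.domain = R.domain)
    (hQ : Q.domain = R.domain) (hR : ∀ x ∈ R.domain, 0 < R.integrand x)
    (hq : ∀ x ∈ R.domain, 0 < Q.integrand x)
    (hsum : EqOn R.integrand (W.integrand + Q.integrand) R.domain) :
    Nonempty (Shadow (of R - of W - of Q)) := by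
  have hw : IsSemialgebraicFunOn ℚ R.domain W.integrand := hW ▸ W.isSemialgebraicFunOn_integrand
  -- the sign cells of `W`
  let E : Fin 3 → Set (Fin n → ℝ) := ![{x | x ∈ R.domain ∧ 0 < W.integrand x},
    {x | x ∈ R.domain ∧ W.integrand x = 0}, {x | x ∈ R.domain ∧ W.integrand x < 0}]
  have hE0 : E 0 = {x | x ∈ R.domain ∧ 0 < W.integrand x} := rfl
  have hE1 : E 1 = {x | x ∈ R.domain ∧ W.integrand x = 0} := rfl
  have hE2 : E 2 = {x | x ∈ R.domain ∧ W.integrand x < 0} := rfl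
  have hE : ∀ k, IsSemialgebraic ℚ (E k) := fun k => by
    fin_cases k
    · exact isSemialgebraic_sep_pos hw
    · exact isSemialgebraic_sep_zero hw
    · exact isSemialgebraic_sep_neg hw
  have hEσ : ∀ k, E k ⊆ R.domain := fun k => by
    fin_cases k <;> exact fun x hx => hx.1
  refine of_triple_partition R W Q hW hQ E hE hEσ (fun k k' hkk => ?_) (fun x hx => ?_) (fun k => ?_)
  · ext x
    simp only [mem_inter_iff, mem_empty_iff_false, iff_false, not_and]
    intro hx hx'
    fin_cases k <;> fin_cases k'
    all_goals first | exact absurd rfl hkk | (simp only [hE0, hE1, hE2, Fin.zero_eta, Fin.mk_one,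
      Fin.reduceFinMk, Fin.isValue, mem_setOf_eq] at hx hx'; linarith [hx.2, hx'.2])
  · rcases lt_trichotomy 0 (W.integrand x) with h | h | h
    · exact mem_iUnion.mpr ⟨0, hx, h⟩
    · exact mem_iUnion.mpr ⟨1, hx, h.symm⟩
    · exact mem_iUnion.mpr ⟨2, hx, h⟩
  · fin_cases k
    · -- `W > 0`: the core
      show Nonempty (Shadow (of (R.restrict (E 0) (hE 0) (hEσ 0)) -
        of (W.restrict (E 0) (hE 0) ((hEσ 0).trans hW.symm.subset)) -
        of (Q.restrict (E 0) (hE 0) ((hEσ 0).trans hQ.symm.subset))))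
      exact of_integrandAdd_pos _ _ _ rfl rfl (fun x hx => hx.2) (fun x hx => hq x hx.1)
        fun x hx => hsum hx.1
    · -- `W = 0`: `R = Q`
      show Nonempty (Shadow (of (R.restrict (E 1) (hE 1) (hEσ 1)) -
        of (W.restrict (E 1) (hE 1) ((hEσ 1).trans hW.symm.subset)) -
        of (Q.restrict (E 1) (hE 1) ((hEσ 1).trans hQ.symm.subset))))
      obtain ⟨S₁⟩ := of_eqOn (r := R.restrict (E 1) (hE 1) (hEσ 1))
        (r' := Q.restrict (E 1) (hE 1) ((hEσ 1).trans hQ.symm.subset)) rfl fun x hx => by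
          have := hsum hx.1
          simp only [IntegralRep.integrand_restrict, Pi.add_apply] at this ⊢
          rw [this, show W.integrand x = 0 from hx.2, zero_add]
      obtain ⟨S₂⟩ := of_eqOn_zero (W.restrict (E 1) (hE 1) ((hEσ 1).trans hW.symm.subset))
        fun x hx => hx.2
      obtain ⟨S⟩ := S₁.sub S₂
      exact S.congr (by abel)
    · -- `W < 0`: `Q = R + (−W)`
      show Nonempty (Shadow (of (R.restrict (E 2) (hE 2) (hEσ 2)) -
        of (W.restrict (E 2) (hE 2) ((hEσ 2).trans hW.symm.subset)) -
        of (Q.restrict (E 2) (hE 2) ((hEσ 2).trans hQ.symm.subset))))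
      obtain ⟨S₁⟩ := of_integrandAdd_pos (Q.restrict (E 2) (hE 2) ((hEσ 2).trans hQ.symm.subset))
        (R.restrict (E 2) (hE 2) (hEσ 2)) (W.restrict (E 2) (hE 2) ((hEσ 2).trans hW.symm.subset)).neg
        rfl rfl
        (fun x hx => hR x hx.1) (fun x hx => by simpa using hx.2) fun x hx => by
          have := hsum hx.1
          simp only [IntegralRep.integrand_restrict, Pi.add_apply, IntegralRep.integrand_neg,
            Pi.neg_apply] at this ⊢
          linarith
      obtain ⟨S₂⟩ := of_neg_pair (r := W.restrict (E 2) (hE 2) ((hEσ 2).trans hW.symm.subset))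
        (r' := (W.restrict (E 2) (hE 2) ((hEσ 2).trans hW.symm.subset)).neg) rfl fun x _ => rfl
      obtain ⟨S₁'⟩ := S₁.neg
      obtain ⟨S⟩ := S₁'.sub S₂
      exact S.congr (by abel)

/-- An integral representation with prescribed `ℚ`-semialgebraic domain and integrand. [folklore] -/
theorem exists_rep {σ : Set (Fin n → ℝ)} (hσ : IsSemialgebraic ℚ σ) {h : (Fin n → ℝ) → ℝ}
    (hs : IsSemialgebraicFunOn ℚ σ h) (hi : IntegrableOn h σ) :
    ∃ X : IntegralRep n, X.domain = σ ∧ X.integrand = h :=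
  ⟨⟨σ, h, hσ, hs, hi⟩, rfl, rfl⟩

/-- **Rule (1b), additivity in the integrand, has vanishing shadow.**
[cite: KontsevichZagier2001, §1.2 rule (1)] -/
theorem of_mem_integrandAddRel {c : FormalRep} (hc : c ∈ integrandAddRel) : Nonempty (Shadow c) := by
  obtain ⟨n, r, r₁, r₂, hd₁, hd₂, hf, rfl⟩ := hc
  set σ := r.domain with hσ_def
  have hσ : IsSemialgebraic ℚ σ := r.isSemialgebraic_domain
  have hσm : MeasurableSet σ := IntegralRep.measurableSet_domain_holds r
  have hf₁ : IsSemialgebraicFunOn ℚ σ r₁.integrand := hd₁ ▸ r₁.isSemialgebraicFunOn_integrand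
  have hf₂ : IsSemialgebraicFunOn ℚ σ r₂.integrand := hd₂ ▸ r₂.isSemialgebraicFunOn_integrand
  have hi₁ : IntegrableOn r₁.integrand σ := hd₁ ▸ r₁.integrableOn
  have hi₂ : IntegrableOn r₂.integrand σ := hd₂ ▸ r₂.integrableOn
  -- the positive integrable weight `q = |f₁| + |f₂| + 1/P`
  set q : (Fin n → ℝ) → ℝ := fun x => |r₁.integrand x| + |r₂.integrand x| + (graphWeight x)⁻¹ with hq
  have hqs : IsSemialgebraicFunOn ℚ σ q :=
    IsSemialgebraicFunOn.add_holds (IsSemialgebraicFunOn.add_holds hf₁.abs hf₂.abs)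
      ((isSemialgebraicFunOn_graphWeight hσ).inv fun x _ => (graphWeight_pos x).ne')
  have hqi : IntegrableOn q σ := (hi₁.abs.add hi₂.abs).add integrable_graphWeight_inv.integrableOn
  have hqpos : ∀ x, 0 < q x := fun x => by
    have := inv_pos.mpr (graphWeight_pos x)
    simp only [hq]; positivity
  have hp₁pos : ∀ x, 0 < r₁.integrand x + q x := fun x => by
    have h1 := neg_abs_le (r₁.integrand x)
    have h2 := abs_nonneg (r₂.integrand x)
    have h3 := inv_pos.mpr (graphWeight_pos x)
    simp only [hq]; linarith
  have hp₂pos : ∀ x, 0 < r₂.integrand x + q x := fun x => by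
    have h1 := neg_abs_le (r₂.integrand x)
    have h2 := abs_nonneg (r₁.integrand x)
    have h3 := inv_pos.mpr (graphWeight_pos x)
    simp only [hq]; linarith
  -- the five auxiliary representations
  obtain ⟨Rq, hRqd, hRqi⟩ := exists_rep hσ hqs hqi
  obtain ⟨R2q, hR2qd, hR2qi⟩ := exists_rep hσ (IsSemialgebraicFunOn.add_holds hqs hqs) (hqi.add hqi)
  obtain ⟨Rp₁, hRp₁d, hRp₁i⟩ := exists_rep hσ (IsSemialgebraicFunOn.add_holds hf₁ hqs) (hi₁.add hqi)
  obtain ⟨Rp₂, hRp₂d, hRp₂i⟩ := exists_rep hσ (IsSemialgebraicFunOn.add_holds hf₂ hqs) (hi₂.add hqi)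
  obtain ⟨Rp, hRpd, hRpi⟩ := exists_rep hσ (IsSemialgebraicFunOn.add_holds r.isSemialgebraicFunOn_integrand
    (IsSemialgebraicFunOn.add_holds hqs hqs)) (r.integrableOn.add (hqi.add hqi))
  -- the five shadows
  obtain ⟨S₁⟩ := of_integrandAdd_posRight Rp₁ r₁ Rq (by rw [hd₁, hRp₁d]) (by rw [hRqd, hRp₁d])
    (fun x _ => by rw [hRp₁i]; exact hp₁pos x) (fun x _ => by rw [hRqi]; exact hqpos x)
    (fun x _ => by simp [hRp₁i, hRqi])
  obtain ⟨S₂⟩ := of_integrandAdd_posRight Rp₂ r₂ Rq (by rw [hd₂, hRp₂d]) (by rw [hRqd, hRp₂d])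
    (fun x _ => by rw [hRp₂i]; exact hp₂pos x) (fun x _ => by rw [hRqi]; exact hqpos x)
    (fun x _ => by simp [hRp₂i, hRqi])
  obtain ⟨S₃⟩ := of_integrandAdd_posRight Rp r R2q (by rw [hRpd]) (by rw [hR2qd, hRpd])
    (fun x hx => by
      rw [hRpd] at hx
      rw [hRpi]
      simp only [Pi.add_apply, hf hx]
      linarith [hp₁pos x, hp₂pos x])
    (fun x _ => by rw [hR2qi]; simp only [Pi.add_apply]; linarith [hqpos x])
    (fun x _ => by simp [hRpi, hR2qi])
  obtain ⟨S₄⟩ := of_integrandAdd_pos Rp Rp₁ Rp₂ (by rw [hRp₁d, hRpd]) (by rw [hRp₂d, hRpd])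
    (fun x _ => by rw [hRp₁i]; exact hp₁pos x) (fun x _ => by rw [hRp₂i]; exact hp₂pos x)
    (fun x hx => by
      rw [hRpd] at hx
      simp only [hRpi, hRp₁i, hRp₂i, Pi.add_apply, hf hx]
      ring)
  obtain ⟨S₅⟩ := of_integrandAdd_pos R2q Rq Rq (by rw [hRqd, hR2qd]) (by rw [hRqd, hR2qd])
    (fun x _ => by rw [hRqi]; exact hqpos x) (fun x _ => by rw [hRqi]; exact hqpos x)
    (fun x _ => by simp [hR2qi, hRqi])
  obtain ⟨S⟩ := S₄.sub S₅
  obtain ⟨S⟩ := S.sub S₃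
  obtain ⟨S⟩ := S.add S₁
  obtain ⟨S⟩ := S.add S₂
  exact S.congr (by abel)

end Shadow

/-! ### Headline -/

/-- Registered helper goal of the stub `stub_tameForm`: rule (1b) (additivity in the integrand) has
vanishing `K₀`-shadow. [cite: KontsevichZagier2001, §1.2 rule (1)] -/
theorem tameForm_aux_shadowIntegrandAdd : ∀ c ∈ integrandAddRel, Nonempty (Shadow c) :=
  fun _ hc => Shadow.of_mem_integrandAddRel hc

end Summit.KontsevichZagierPeriods.KontsevichZagierPeriods.BetaCancellationDivisorSlicing

end
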